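/-
Copyright: harness cell b2b-lgcu-borel (gen 16).  Honest framing: the VALUE here is a THEOREM
(unconditional parity lemma for all odd primes; family-I corollary conditional on the named
classical hypothesis `DicksonList`) — NOT summit progress; the crux item `SubgroupIdentityDesigns`
(stmt-MatrixMultiplication-14079) stays open and untouched.
-/
import Mathlib
import Summits.MatrixMultiplication.MatrixMultiplication.Theorems.SubgroupIdentityDesigns.Negative.FamilyIArithmetic

/-!
# Family I: at most one member is conjugate into the Singer cycle itself

Route `LevelGradedCohnUmans`, crux `SubgroupIdentityDesigns`, negative side, cell `(m,k) = (2,1)`,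
residual range `ε ∈ (233/236, 1]`.  By `DicksonFamilyI` / `FamilyIArithmetic`, modulo Dickson every
surviving witness triple consists of three subgroups conjugate into the normaliser `N(C)` of the
Singer cycle `C = {[[a, n b], [b, a]]}` (`SingerCycleOrder.singerPlusSubgroup n`), with projective
images of order `p + 1` and scalar parts `Sᵢ = Hᵢ ∩ Z` of pairwise coprime orders `zᵢ ≥ 2`,
`z₁ z₂ z₃ = p - 1`.  Each member is therefore of one of two types: conjugate into `C` itself
("cyclic type", the sieve's `A_ns`) or only into `N(C)` ("dihedral type", `B_ns`).  This file adds: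

* `even_scalar_of_conj_singerPlus` (UNCONDITIONAL, `p ≠ 2`, `n` a non-square): a subgroup of EVEN
  order conjugate into `C` has a scalar part of EVEN order — because its involution (Cauchy) is an
  involution of `C`, hence `-1` (`SingerCycleOrder.singerPlus_involution`), which is scalar;
* `atMostOne_conj_singerPlus_of_dicksonList` (mod Dickson, `p ≥ 59`, `0 < ε ≤ 1`): in a witness
  triple AT MOST ONE member is conjugate into `C`; i.e. at least two members are of dihedral type —
  matching the order-profile sieve (ORACLE-g16 §G16-2/5: every family-I profile is
  `B_ns, B_ns, A_ns` or `B_ns, B_ns, B_ns`, the `A_ns` member carrying the even `zᵢ`).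

Scope, honestly: a structural constraint on the residual family only; decides nothing about design
existence; VALUE = THEOREM, NOT summit progress; the crux item is untouched and remains open.
Report: `run/shared/lean/b2b/levelgraded-cu/ORACLE-g16.md` §G16-1/6.
-/

set_option linter.dupNamespace false

noncomputable section

open scoped Classical
open Summit.MatrixMultiplication.MatrixMultiplication.Theorems.LieRankDesigns.Negative (GLm Mat budget)
open Literature.Barriers.MatrixMultiplication (SubgroupTPP)

namespace Summit.MatrixMultiplication.MatrixMultiplication.Theorems.SubgroupIdentityDesigns.Negative

section SingerTypeParity

variable {p : ℕ} [hp : Fact p.Prime]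

/-- **Parity lemma** (UNCONDITIONAL, `p ≠ 2`, `n` a non-square): a subgroup of even order that
is conjugate into the Singer cycle `C` has a scalar part `H ∩ Z` of even order. -/
theorem even_scalar_of_conj_singerPlus (hp2 : p ≠ 2) {n : ZMod p}
    (hn : ∀ x : ZMod p, x * x ≠ n) {H : Subgroup (GLm p 2)} {g : GLm p 2}
    (hg : ∀ x ∈ H, IsSingerPlus n (g * x * g⁻¹)) (heven : Even (Nat.card H)) :
    Even (Nat.card (H.comap (scalarHom p 2))) := by
  classical
  set H' := H.map (MulAut.conj g).toMonoidHom with hH'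
  have hmem : ∀ y, y ∈ H' ↔ g⁻¹ * y * g ∈ H := fun y => mem_map_conj_iff'
  have hH'C : ∀ y ∈ H', IsSingerPlus n y := by
    intro y hy
    have e : y = g * (g⁻¹ * y * g) * g⁻¹ := by group
    have h := hg _ ((hmem y).mp hy)
    rw [← e] at h
    exact h
  have hcardH' : Nat.card H' = Nat.card H := by
    rw [hH', Subgroup.card_map_of_injective (fun x y h => (MulAut.conj g).injective h)]
  -- H' has even order, hence an involution r, which lies in C, hence r = -1
  have hev : 2 ∣ Nat.card H' := by rw [hcardH']; exact even_iff_two_dvd.mp heven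
  obtain ⟨r, hr⟩ := exists_prime_orderOf_dvd_card' 2 hev
  have hr2 : ((r : GLm p 2)) * (r : GLm p 2) = 1 := by
    have h := pow_orderOf_eq_one r
    rw [hr] at h
    have h' := congrArg (fun x : H' => (x : GLm p 2)) h
    simpa [pow_two] using h'
  have hr1 : (r : GLm p 2) ≠ 1 := by
    intro h
    have : r = 1 := Subtype.ext h
    rw [this, orderOf_one] at hr
    exact absurd hr (by norm_num)
  have hrneg : (r : GLm p 2) = scalarHom p 2 (-1) := by
    rcases singerPlus_involution hp2 hn (hH'C _ r.2) hr2 with h | h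
    · exact absurd h hr1
    · exact h
  -- so -1 ∈ H' and (scalars are central) -1 ∈ H
  have hm' : scalarHom p 2 (-1) ∈ H := by
    have h := (hmem _).mp (hrneg ▸ r.2)
    rwa [mul_assoc, scalarHom_comm, ← mul_assoc, inv_mul_cancel, one_mul] at h
  have hu : (-1 : (ZMod p)ˣ) ∈ H.comap (scalarHom p 2) := by
    rw [Subgroup.mem_comap]; exact hm'
  have h2 : orderOf (-1 : (ZMod p)ˣ) = 2 := by
    refine orderOf_eq_prime (by rw [sq, neg_one_mul, neg_neg]) ?_
    intro h
    have h' := congrArg Units.val h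
    rw [Units.val_neg, Units.val_one] at h'
    exact one_ne_neg_one hp2 h'.symm
  have hdvd := Subgroup.orderOf_dvd_natCard _ hu
  rw [h2] at hdvd
  exact even_iff_two_dvd.mpr hdvd

/-- **AT MOST ONE CYCLIC-TYPE MEMBER, mod Dickson** (`p ≥ 59`, `0 < ε ≤ 1`): in a subgroup-TPP
triple with a level-one identity design satisfying the level-one crux inequality, no two members
are both conjugate into the Singer cycle `C` (their scalar parts would both be even, against the
scalar law); so at least two members are of dihedral type inside `N(C)`. -/
theorem atMostOne_conj_singerPlus_of_dicksonList (hp59 : 59 ≤ p) {n : ZMod p}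
    (hn : ∀ x : ZMod p, x * x ≠ n) (hD : DicksonList p n)
    {ε : ℝ} (hε : 0 < ε) (hε1 : ε ≤ 1)
    {H₁ H₂ H₃ : Subgroup (GLm p 2)} (htpp : SubgroupTPP H₁ H₂ H₃)
    (hdesign : ∃ c : Mat p 2 → ℂ, (∀ M, 1 < M.rank → c M = 0) ∧
      (∑ M, c M * ZMod.stdAddChar (Matrix.trace (M * ((1 : GLm p 2) : Mat p 2)))) = 1 ∧
      ∀ a ∈ H₁, ∀ b ∈ H₂, ∀ g ∈ H₃, a * b * g ≠ 1 →
        (∑ M, c M *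
          ZMod.stdAddChar (Matrix.trace (M * ((a * b * g : GLm p 2) : Mat p 2)))) = 0)
    (hwit : budget p 2 1 (2 + ε) <
      ((Nat.card H₁ * Nat.card H₂ * Nat.card H₃ : ℕ) : ℝ) ^ ((2 + ε) / 3)) :
    ((∃ g : GLm p 2, ∀ x ∈ H₁, IsSingerPlus n (g * x * g⁻¹)) →
        ¬ ∃ g : GLm p 2, ∀ x ∈ H₂, IsSingerPlus n (g * x * g⁻¹)) ∧
    ((∃ g : GLm p 2, ∀ x ∈ H₁, IsSingerPlus n (g * x * g⁻¹)) →
        ¬ ∃ g : GLm p 2, ∀ x ∈ H₃, IsSingerPlus n (g * x * g⁻¹)) ∧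
    ((∃ g : GLm p 2, ∀ x ∈ H₂, IsSingerPlus n (g * x * g⁻¹)) →
        ¬ ∃ g : GLm p 2, ∀ x ∈ H₃, IsSingerPlus n (g * x * g⁻¹)) := by
  have hp2 : p ≠ 2 := by omega
  obtain ⟨k₁, k₂, k₃, -, -, -, c12, c13, c23, -⟩ :=
    witness_scalars_of_dicksonList hp59 hn hD hε hε1 htpp hdesign hwit
  have hp1 : Even (p + 1) := (hp.out.odd_of_ne_two hp2).add_one
  have ev₁ : Even (Nat.card H₁) := by rw [k₁]; exact hp1.mul_left _
  have ev₂ : Even (Nat.card H₂) := by rw [k₂]; exact hp1.mul_left _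
  have ev₃ : Even (Nat.card H₃) := by rw [k₃]; exact hp1.mul_left _
  -- two even scalar parts contradict coprimality
  have key : ∀ {s t : ℕ}, Nat.Coprime s t → Even s → Even t → False := by
    intro s t hst hs ht
    have h2 : 2 ∣ Nat.gcd s t := Nat.dvd_gcd (even_iff_two_dvd.mp hs) (even_iff_two_dvd.mp ht)
    rw [hst] at h2
    exact absurd (Nat.le_of_dvd one_pos h2) (by norm_num)
  refine ⟨?_, ?_, ?_⟩
  · rintro ⟨g₁, hg₁⟩ ⟨g₂, hg₂⟩
    exact key c12 (even_scalar_of_conj_singerPlus hp2 hn hg₁ ev₁)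
      (even_scalar_of_conj_singerPlus hp2 hn hg₂ ev₂)
  · rintro ⟨g₁, hg₁⟩ ⟨g₃, hg₃⟩
    exact key c13 (even_scalar_of_conj_singerPlus hp2 hn hg₁ ev₁)
      (even_scalar_of_conj_singerPlus hp2 hn hg₃ ev₃)
  · rintro ⟨g₂, hg₂⟩ ⟨g₃, hg₃⟩
    exact key c23 (even_scalar_of_conj_singerPlus hp2 hn hg₂ ev₂)
      (even_scalar_of_conj_singerPlus hp2 hn hg₃ ev₃)

end SingerTypeParity

end Summit.MatrixMultiplication.MatrixMultiplication.Theorems.SubgroupIdentityDesigns.Negative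

end
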